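import Mathlib
import HarnessLib
import Summits.NavierStokesRegularity.NavierStokesRegularity.Theorems.TaylorModelRungThreeCertificateSoundBridge
import Summits.NavierStokesRegularity.NavierStokesRegularity.Theorems.TaylorModelRungThreeCertificateReadouts

/-!
# Crux K1b-DR (stmt-NavierStokesRegularity-23954), line `taylor-model` — certificate SOUNDNESS for the `Readouts`
# block, part 1: scalar transfer under a monotone `φ : K →+* ℝ`, products, scalars, section before/after

Soundness lemmas for the clause-family checkers of `Theorems/TaylorModelRungThreeCertificateReadouts.lean`
(CERT-CONTRACT-23954 v1 §4 READOUTS) against the interpretation `CertTables.toCertData φ T` of the format of record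
(p602753): from `checkRO_products = true`, `checkRO_scalars = true`, `checkRO_section = true` the corresponding
conjuncts of `CertData.Readouts (toCertData φ T)` at stage `j`, for an exact ordered field `K` and a MONOTONE ring map
`φ : K →+* ℝ` (then `φ` is strictly monotone, commutes with `|·|`, `max`, `min`). Uses the list-coding / window bridge
of `…CertificateSoundBridge` by name.

MODEL-lattice rung TL-M3 only; nothing here is a statement about the Navier–Stokes equations.
-/

-- the sub-problem namespace repeats the summit name by design (D-0017)
set_option linter.dupNamespace false

namespace Summit.NavierStokesRegularity.NavierStokesRegularity.Theorems.TaylorModelCert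

open scoped BigOperators
open Literature.Analysis.FluidPDE.TaoCascade Literature.Analysis.FluidPDE.TaoCascade.TaylorChain

/-! ### A monotone ring map `K →+* ℝ` -/

section Phi

variable {K : Type} [Field K] [LinearOrder K] {φ : K →+* ℝ}

/-- A monotone ring map out of a field is strictly monotone. [folklore] -/
theorem phi_strictMono (hφ : Monotone φ) : StrictMono φ := hφ.strictMono_of_injective φ.injective

/-- `φ` reflects and preserves `≤`. [folklore] -/
theorem phi_le_iff (hφ : Monotone φ) {a b : K} : φ a ≤ φ b ↔ a ≤ b := (phi_strictMono hφ).le_iff_le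

/-- `φ` reflects and preserves `<`. [folklore] -/
theorem phi_lt_iff (hφ : Monotone φ) {a b : K} : φ a < φ b ↔ a < b := (phi_strictMono hφ).lt_iff_lt

/-- `φ` commutes with `max`. [folklore] -/
theorem phi_max (hφ : Monotone φ) (a b : K) : φ (max a b) = max (φ a) (φ b) := hφ.map_max

/-- `φ` commutes with `min`. [folklore] -/
theorem phi_min (hφ : Monotone φ) (a b : K) : φ (min a b) = min (φ a) (φ b) := hφ.map_min

/-- `φ` commutes with `|·|`. [folklore] -/
theorem phi_abs (hφ : Monotone φ) (a : K) : φ |a| = |φ a| := by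
  show φ (max a (-a)) = max (φ a) (-φ a)
  rw [hφ.map_max, map_neg]

/-- `0 ≤ a` transfers. [folklore] -/
theorem phi_nonneg (hφ : Monotone φ) {a : K} (h : 0 ≤ a) : 0 ≤ φ a := by simpa using hφ h

/-- `0 < a` transfers. [folklore] -/
theorem phi_pos (hφ : Monotone φ) {a : K} (h : 0 < a) : 0 < φ a := by simpa using phi_strictMono hφ h

end Phi

section ListFacts

variable {K : Type} [Field K] {φ : K →+* ℝ}

/-- `prodN` with a multiplicative initial value. [folklore] -/
theorem foldr_mul_init (l : List ℕ) (f : ℕ → K) (a : K) :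
    l.foldr (fun c acc => f c * acc) a = l.foldr (fun c acc => f c * acc) 1 * a := by
  induction l with
  | nil => simp
  | cons c l ih => simp only [List.foldr_cons]; rw [ih, mul_assoc]

/-- `prodN` is the `Finset.range` product. [folklore] -/
theorem prodN_eq (n : ℕ) (f : ℕ → K) : prodN n f = ∏ c ∈ Finset.range n, f c := by
  induction n with
  | zero => rfl
  | succ n ih =>
    unfold prodN at ih ⊢
    rw [List.range_succ, List.foldr_append, Finset.prod_range_succ, List.foldr_cons, List.foldr_nil,
      foldr_mul_init, ih, mul_one]

/-- `prodIco` is the `Finset.Ico` product. [folklore] -/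
theorem prodIco_eq (a b : ℕ) (f : ℕ → K) : prodIco a b f = ∏ u ∈ Finset.Ico a b, f u := by
  unfold prodIco
  rw [prodN_eq, Finset.prod_Ico_eq_prod_range]

/-- `φ` of `prodIco`. [folklore] -/
theorem phi_prodIco (a b : ℕ) (f : ℕ → K) : φ (prodIco a b f) = ∏ u ∈ Finset.Ico a b, φ (f u) := by
  rw [prodIco_eq, map_prod]

/-- `φ` of `sumN`. [folklore] -/
theorem phi_sumN (n : ℕ) (f : ℕ → K) : φ (sumN n f) = ∑ c ∈ Finset.range n, φ (f c) := by
  rw [sumN_eq, map_sum]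

/-- Entries beyond a list are junk `0`. [folklore] -/
theorem vget_of_le {L : Type} [Field L] (v : List L) {c : ℕ} (hc : v.length ≤ c) : vget v c = 0 :=
  List.getD_eq_default _ _ hc

end ListFacts

/-! ### Bounding a window covector -/

namespace CertTables

section Cov

variable {K : Type} [Field K] (φ : K →+* ℝ) (T : CertTables K)

/-- `|covR w y| ≤ Σ |φ w_c| · r_c` from coordinate bounds `|y_c| ≤ r_c`. [folklore] -/
theorem abs_covR_le (w : List K) (y : Fin 4 → ℤ → ℝ) (r : ℕ → ℝ) (hy : ∀ c < T.n, |T.wv y c| ≤ r c) :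
    |T.covR φ w y| ≤ ∑ c ∈ Finset.range T.n, |φ (vget w c)| * r c := by
  rw [T.covR_apply φ]
  refine (Finset.abs_sum_le_sum_abs _ _).trans (Finset.sum_le_sum fun c hc => ?_)
  rw [Finset.mem_range] at hc
  rw [abs_mul]
  exact mul_le_mul_of_nonneg_left (hy c hc) (abs_nonneg _)

/-- `covR w (linR A ξ) = Σ_{c'} φ (Σ_c w_c A_{c c'}) · ξ_{c'}` (the covector `wᵀ A`). [folklore] -/
theorem covR_linR (w : List K) (A : List (List K)) (ξ : Fin 4 → ℤ → ℝ) :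
    T.covR φ w (T.linR φ A ξ) =
      ∑ c' ∈ Finset.range T.n, φ (sumN T.n fun c => vget w c * mget A c c') * T.wv ξ c' := by
  rw [T.covR_apply φ]
  have : ∀ c ∈ Finset.range T.n, φ (vget w c) * T.wv (T.linR φ A ξ) c =
      ∑ c' ∈ Finset.range T.n, φ (vget w c) * φ (mget A c c') * T.wv ξ c' := by
    intro c hc
    rw [Finset.mem_range] at hc
    rw [T.wv_linR φ A ξ hc, Finset.mul_sum]
    refine Finset.sum_congr rfl fun c' _ => by ring
  rw [Finset.sum_congr rfl this, Finset.sum_comm]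
  refine Finset.sum_congr rfl fun c' _ => ?_
  rw [phi_sumN, Finset.sum_mul]
  refine Finset.sum_congr rfl fun c _ => by rw [map_mul]

/-- `covR w (vecR x) = φ (Σ_c w_c x_c)`. [folklore] -/
theorem covR_vecR (w x : List K) : T.covR φ w (T.vecR φ x) = φ (sumN T.n fun c => vget w c * vget x c) := by
  rw [T.covR_apply φ, phi_sumN]
  refine Finset.sum_congr rfl fun c hc => ?_
  rw [Finset.mem_range] at hc
  rw [T.wv_vecR φ x hc, map_mul]

/-- The covector of an EMPTY row is the zero functional. [folklore] -/
theorem covR_nil (y : Fin 4 → ℤ → ℝ) : T.covR φ [] y = 0 := by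
  rw [T.covR_apply φ]
  refine Finset.sum_eq_zero fun c _ => ?_
  rw [show vget ([] : List K) c = 0 from rfl, map_zero, zero_mul]

end Cov

/-! ### PRODUCTS -/

section Products

variable {K : Type} [Field K] [LinearOrder K] {φ : K →+* ℝ} (hφ : Monotone φ) (T : CertTables K)
include hφ

/-- Soundness of `checkRO_products`: the flow-Lipschitz product clauses of `Readouts` at stage `j`. [folklore] -/
theorem ro_products (j : ℕ) (h : T.checkRO_products j = true) :
    ∀ s', s' < (T.toCertData φ).S j →
      (T.toCertData φ).L1 j s' ≤ (T.toCertData φ).Λ j ∧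
      (s' + 1 < (T.toCertData φ).S j →
        (T.toCertData φ).L1 j s' * (T.toCertData φ).L1 j (s' + 1) ≤ (T.toCertData φ).Λ j) ∧
      ∀ s'', s' + 1 < s'' → s'' < (T.toCertData φ).S j →
        (T.toCertData φ).L1 j s' * ((T.toCertData φ).NCi j (s' + 1) *
          (∏ u ∈ Finset.Ico (s' + 1) s'', (1 + (T.toCertData φ).κB j u)) *
          ((T.toCertData φ).ρO j s'' - (T.toCertData φ).EO j s'')) * (T.toCertData φ).L1 j s'' ≤
        (T.toCertData φ).Λ j := by
  simp only [checkRO_products, allN_eq_true, Bool.and_eq_true, decide_eq_true_eq] at h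
  intro s' hs'
  obtain ⟨⟨h1, h2⟩, h3⟩ := h s' hs'
  refine ⟨?_, fun hs1 => ?_, fun s'' hs1 hs2 => ?_⟩
  · simpa [toCertData] using hφ h1
  · simpa [toCertData, map_mul] using hφ (h2 hs1)
  · have := hφ (h3 s'' hs2 hs1)
    simpa [toCertData, map_mul, map_sub, phi_prodIco, map_add] using this

end Products

/-! ### SCALARS -/

section Scalars

variable {K : Type} [Field K] [LinearOrder K] {φ : K →+* ℝ} (hφ : Monotone φ) (T : CertTables K)
include hφ

/-- `φ (sigAbs j) = Σ_c |φ σf_c| · φ (ω_c)`. [folklore] -/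
theorem phi_sigAbs (j : ℕ) :
    φ (T.sigAbs j) = ∑ c ∈ Finset.range T.n, |φ (vget (T.stage j).σf c)| * φ (T.wgt j c) := by
  unfold sigAbs
  rw [phi_sumN]
  refine Finset.sum_congr rfl fun c _ => by rw [map_mul, phi_abs hφ]

/-- The section covector on a ball: `|σf v| ≤ N · φ (sigAbs)` for `v ∈ Ball(N)`. [folklore] -/
theorem abs_sigma_le (j : ℕ) (v : Fin 4 → ℤ → ℝ) (N : ℝ) (hv : (T.toCertData φ).InBall j v N) :
    |(T.toCertData φ).σf j v| ≤ N * φ (T.sigAbs j) := by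
  rw [T.inBall_iff φ] at hv
  have h := T.abs_covR_le φ (T.stage j).σf v (fun c => N * φ (T.wgt j c)) hv
  rw [phi_sigAbs hφ, Finset.mul_sum]
  refine h.trans (le_of_eq (Finset.sum_congr rfl fun c _ => by ring))

/-- Soundness of `checkRO_scalars`, clause `0 < γ`. [folklore] -/
theorem ro_gamma (j : ℕ) (h : T.checkRO_scalars j = true) : 0 < (T.toCertData φ).γ j := by
  simp only [checkRO_scalars, allN_eq_true, Bool.and_eq_true, decide_eq_true_eq] at h
  simpa [toCertData] using phi_pos hφ h.1.1.1.1

/-- Soundness of `checkRO_scalars`, clause `‖σf‖ ≤ Nσ` on the unit ball. [folklore] -/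
theorem ro_sigma (j : ℕ) (h : T.checkRO_scalars j = true) :
    ∀ v : Fin 4 → ℤ → ℝ, (T.toCertData φ).InBall j v 1 → |(T.toCertData φ).σf j v| ≤ (T.toCertData φ).Nσ j := by
  simp only [checkRO_scalars, allN_eq_true, Bool.and_eq_true, decide_eq_true_eq] at h
  intro v hv
  have h1 := T.abs_sigma_le hφ j v 1 hv
  rw [one_mul] at h1
  exact h1.trans (by simpa [toCertData] using hφ h.1.1.1.2)

/-- Soundness of `checkRO_scalars`, the `ΛX` clause. [folklore] -/
theorem ro_lambdaX (j : ℕ) (h : T.checkRO_scalars j = true) :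
    (1 + (T.toCertData φ).bb j * ((T.toCertData φ).mT j ((T.toCertData φ).S j - 1) +
        (T.toCertData φ).Sp j ((T.toCertData φ).S j - 1)) ^ 2 * (T.toCertData φ).Nσ j / (T.toCertData φ).γ j) *
      ((T.toCertData φ).NCi j 0 * (∏ u ∈ Finset.Ico 0 ((T.toCertData φ).S j - 1), (1 + (T.toCertData φ).κB j u)) *
        ((T.toCertData φ).ρO j ((T.toCertData φ).S j - 1) - (T.toCertData φ).EO j ((T.toCertData φ).S j - 1))) *
      (T.toCertData φ).L1 j ((T.toCertData φ).S j - 1) ≤ (T.toCertData φ).ΛX j := by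
  simp only [checkRO_scalars, allN_eq_true, Bool.and_eq_true, decide_eq_true_eq] at h
  have := hφ h.1.1.2
  simpa [toCertData, map_mul, map_sub, phi_prodIco, map_add, map_div₀, map_pow] using this

/-- Soundness of `checkRO_scalars`, clause `0 ≤ NDL ∧ NDL·ΛX·dm ≤ β` (all face indices; junk `0` beyond the
tables). [folklore] -/
theorem ro_ndl (j : ℕ) (h : T.checkRO_scalars j = true) :
    ∀ l, 0 ≤ (T.toCertData φ).NDL j l ∧
      (T.toCertData φ).NDL j l * (T.toCertData φ).ΛX j * (T.toCertData φ).dm j ≤ (T.toCertData φ).β j l := by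
  simp only [checkRO_scalars, allN_eq_true, Bool.and_eq_true, decide_eq_true_eq] at h
  intro l
  by_cases hl : l < max (T.stage j).NDL.length (T.stage j).β.length
  · obtain ⟨h1, h2⟩ := h.1.2 l hl
    exact ⟨by simpa [toCertData] using phi_nonneg hφ h1, by simpa [toCertData, map_mul] using hφ h2⟩
  · rw [not_lt, max_le_iff] at hl
    have e1 : vget (T.stage j).NDL l = 0 := vget_of_le _ hl.1
    have e2 : vget (T.stage j).β l = 0 := vget_of_le _ hl.2
    simp [toCertData, e1, e2]

/-- Soundness of `checkRO_scalars`, the `L1` guard `1/(1 - bb (mC + ρO) h)² ≤ L1`. [folklore] -/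
theorem ro_L1guard (j : ℕ) (h : T.checkRO_scalars j = true) :
    ∀ s', s' < (T.toCertData φ).S j →
      1 / (1 - (T.toCertData φ).bb j * ((T.toCertData φ).mC j s' + (T.toCertData φ).ρO j s') *
        (T.toCertData φ).h j s') ^ 2 ≤ (T.toCertData φ).L1 j s' := by
  simp only [checkRO_scalars, allN_eq_true, Bool.and_eq_true, decide_eq_true_eq] at h
  intro s' hs'
  obtain ⟨h1, h2⟩ := h.2 s' hs'
  have h1' := phi_strictMono hφ h1
  have h2' := hφ h2
  simp only [map_mul, map_add, map_one, map_sub, map_pow] at h1' h2'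
  have hpos : 0 < (1 - φ (T.stage j).bb * (φ (T.node j s').mC + φ (T.node j s').ρO) * φ (T.step j s').h) ^ 2 := by
    have : 0 < 1 - φ (T.stage j).bb * (φ (T.node j s').mC + φ (T.node j s').ρO) * φ (T.step j s').h := by linarith
    positivity
  show 1 / (1 - φ (T.stage j).bb * (φ (T.node j s').mC + φ (T.node j s').ρO) * φ (T.step j s').h) ^ 2 ≤ φ (T.step j s').L1
  rw [div_le_iff₀ hpos]
  linarith

end Scalars

/-! ### SECTION BEFORE / AFTER -/

section SectionClauses

variable {K : Type} [Field K] [LinearOrder K] {φ : K →+* ℝ} (hφ : Monotone φ) (T : CertTables K)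
include hφ

omit [LinearOrder K] hφ in
/-- `σf (x_s) = φ (sigCtr j s)`. [folklore] -/
theorem sigma_x (j s : ℕ) : (T.toCertData φ).σf j ((T.toCertData φ).x j s) = φ (T.sigCtr j s) := by
  show T.covR φ (T.stage j).σf (T.vecR φ (T.node j s).x) = _
  rw [T.covR_vecR φ]
  rfl

/-- `|σf (Cm_s ξ)| ≤ φ (sigBox j s)` for `ξ` in the `rP_s`-box. [folklore] -/
theorem abs_sigma_Cm_le (j s : ℕ) (ξ : Fin 4 → ℤ → ℝ)
    (hξ : ∀ i k, -T.Kb ≤ k → k ≤ T.Ka → |ξ i k| ≤ T.vecR φ (T.node j s).rP i k) :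
    |(T.toCertData φ).σf j ((T.toCertData φ).Cm j s ξ)| ≤ φ (T.sigBox j s) := by
  rw [T.box_iff φ] at hξ
  show |T.covR φ (T.stage j).σf (T.linR φ (T.node j s).Cm ξ)| ≤ _
  rw [T.covR_linR φ, sigBox, phi_sumN]
  refine (Finset.abs_sum_le_sum_abs _ _).trans (Finset.sum_le_sum fun c' hc' => ?_)
  rw [Finset.mem_range] at hc'
  rw [abs_mul, map_mul, phi_abs hφ]
  exact mul_le_mul_of_nonneg_left (hξ c' hc') (abs_nonneg _)

/-- Soundness of `checkRO_section`: SECTION BEFORE at node `S-1` and SECTION AFTER at node `S`. [folklore] -/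
theorem ro_section (j : ℕ) (h : T.checkRO_section j = true) :
    (∀ ξ e : Fin 4 → ℤ → ℝ,
      (∀ i k, -(T.toCertData φ).Kb ≤ k → k ≤ (T.toCertData φ).Ka →
        |ξ i k| ≤ (T.toCertData φ).rP j ((T.toCertData φ).S j - 1) i k) →
      (T.toCertData φ).InBall j e ((T.toCertData φ).E j ((T.toCertData φ).S j - 1)) →
      (T.toCertData φ).σf j ((T.toCertData φ).x j ((T.toCertData φ).S j - 1) +
        (T.toCertData φ).Cm j ((T.toCertData φ).S j - 1) ξ + e) < (T.toCertData φ).lev j) ∧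
    (∀ ξ e : Fin 4 → ℤ → ℝ,
      (∀ i k, -(T.toCertData φ).Kb ≤ k → k ≤ (T.toCertData φ).Ka →
        |ξ i k| ≤ (T.toCertData φ).rP j ((T.toCertData φ).S j) i k) →
      (T.toCertData φ).InBall j e ((T.toCertData φ).E j ((T.toCertData φ).S j)) →
      (T.toCertData φ).lev j < (T.toCertData φ).σf j ((T.toCertData φ).x j ((T.toCertData φ).S j) +
        (T.toCertData φ).Cm j ((T.toCertData φ).S j) ξ + e)) := by
  simp only [checkRO_section, Bool.and_eq_true, decide_eq_true_eq] at h
  obtain ⟨hB, hA⟩ := h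
  have hB' := phi_strictMono hφ hB
  have hA' := phi_strictMono hφ hA
  simp only [map_add, map_sub, map_mul] at hB' hA'
  constructor
  · intro ξ e hξ he
    rw [map_add, map_add, T.sigma_x (φ := φ)]
    have h1 := T.abs_sigma_Cm_le hφ j ((T.stage j).S - 1) ξ hξ
    have h2 := T.abs_sigma_le hφ j e _ he
    rw [abs_le] at h1 h2
    show φ (T.sigCtr j ((T.stage j).S - 1)) + T.covR φ (T.stage j).σf (T.linR φ (T.node j ((T.stage j).S - 1)).Cm ξ) +
      T.covR φ (T.stage j).σf e < φ (T.stage j).lev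
    change -φ (T.sigBox j ((T.stage j).S - 1)) ≤ T.covR φ (T.stage j).σf (T.linR φ (T.node j ((T.stage j).S - 1)).Cm ξ) ∧
      T.covR φ (T.stage j).σf (T.linR φ (T.node j ((T.stage j).S - 1)).Cm ξ) ≤ φ (T.sigBox j ((T.stage j).S - 1)) at h1
    change -(φ (T.node j ((T.stage j).S - 1)).E * φ (T.sigAbs j)) ≤ T.covR φ (T.stage j).σf e ∧
      T.covR φ (T.stage j).σf e ≤ φ (T.node j ((T.stage j).S - 1)).E * φ (T.sigAbs j) at h2
    linarith [h1.2, h2.2]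
  · intro ξ e hξ he
    rw [map_add, map_add, T.sigma_x (φ := φ)]
    have h1 := T.abs_sigma_Cm_le hφ j (T.stage j).S ξ hξ
    have h2 := T.abs_sigma_le hφ j e _ he
    rw [abs_le] at h1 h2
    show φ (T.stage j).lev < φ (T.sigCtr j (T.stage j).S) + T.covR φ (T.stage j).σf (T.linR φ (T.node j (T.stage j).S).Cm ξ) +
      T.covR φ (T.stage j).σf e
    change -φ (T.sigBox j (T.stage j).S) ≤ T.covR φ (T.stage j).σf (T.linR φ (T.node j (T.stage j).S).Cm ξ) ∧
      T.covR φ (T.stage j).σf (T.linR φ (T.node j (T.stage j).S).Cm ξ) ≤ φ (T.sigBox j (T.stage j).S) at h1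
    change -(φ (T.node j (T.stage j).S).E * φ (T.sigAbs j)) ≤ T.covR φ (T.stage j).σf e ∧
      T.covR φ (T.stage j).σf e ≤ φ (T.node j (T.stage j).S).E * φ (T.sigAbs j) at h2
    linarith [h1.1, h2.1]

end SectionClauses

end CertTables

end Summit.NavierStokesRegularity.NavierStokesRegularity.Theorems.TaylorModelCert
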